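/-
Copyright (c) 2026 the pub-hodgecm-mathlib formalisation cell (harness21).  Prover seat hodgecm-mathlib-K2E1-p10 (g6), Track B ∕ K2-LIT, h413 =
`stmt-HodgeConjecture-24833`, route `HCCMUnconditional`; R90-TF S8 «ContSpec-n½», S8 dealer R90-CS-plan (g3) DEAL S8-R212 (1) 2026-09-05T01:48:09Z
«THE (M) SOCKET ROAD, FILE 1» over the (M) ROAD CENSUS of K2E1-p10 (g5) `K2/K2E1-p10/g5/CENSUS-M-sock299.K2E1-p10-g5.md` f283641be139b1c0 and this seat's
census `K2/K2E1-p10/g6/CENSUS-M-FILE1-IsPiNOfLetters.K2E1-p10-g6.md` fbd6ab8ae97e2443.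
-/
import Literature.NumberTheory.Rogawski1990.GlobalAPacketMembership                        -- ★ D6 `IsXiLocalFamily` ∕ `LocalConstituentsIn` ∕ `cmSplitPacket` ∕ `splitWitness`; ★ `KeysCaseTwoLabels`, `Gqs`, `qsForm`
import Literature.NumberTheory.Rogawski1990.SupercuspidalNotSphericalCofinite              -- ★ `IrrClass.isSupercuspidal_comap_iff`, ★ `Representation.mem_contragredient_comp_iff`
import Literature.NumberTheory.Automorphic.IrreducibleClassesComap                         -- ★ `IrrClass.comap`, `comap_mk`, `SmoothIrrep.comap_ρ`
import Literature.NumberTheory.Automorphic.UnitaryGroupQuasiSplitCMDatum                   -- ★ `quasiSplit`, `UnitaryGroup.cmConj_antidiagonal_transpose`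
import Literature.NumberTheory.Automorphic.QuadraticHeckeCharacterCM                       -- ★ `quadraticHeckeCharCM` (ω_{L∕L⁺})
import Literature.NumberTheory.Automorphic.AdeleBaseChange                                 -- ★ `AdeleRing.ideleBaseChange`
import Summits.HodgeConjecture.HodgeConjecture.Theorems.F0P3cDbTKeysLabelRigidity          -- ★ `keysLabelsCM_isSquareIntegrable_of_isHaarMeasure` (Keys labels rigid across Haar measures; over ★ `keysCaseTwo_holds`)
import Summits.HodgeConjecture.HodgeConjecture.Theorems.F0P3cStCharTSNe                    -- ★ `not_isSupercuspidal_of_not_isSquareIntegrable_gqs` (compact centre at non-split `v`)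
import Summits.HodgeConjecture.HodgeConjecture.Theorems.F0P3cStCharTSPi2SqInt              -- ★ `isSquareIntegrable_pi2_of_keysLabels` (`π²` IS `L²`)
import HarnessLib

/-!
# R90 · S8 «ContSpec-n½» — `R90S8ResMiddleResidueIsPiNOfLettersU3`: the (M) socket `sock_S8_res_middleResidue_isPiN` (B ED. 7 :299) HYPOTHESIS-FIRST —
# «every irreducible `P′` whose local constituents are pinned to `πⁿ(ξ_v)` has `π_v = πⁿ(ξ_v)` for all finite `v`» [Rogawski1990 §12.2 (3) p. 173, §13.9 (ii) p. 229]

Cell `pub/hodgecm-mathlib`, crux H413 = `stmt-HodgeConjecture-24833` (lane `--kind proof --supports stmt-HodgeConjecture-24833 --as helper`), route of record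
`HCCMUnconditional`; programme R90-TF, section S8; hand K2E1-p10 (g6) (deal S8-R212 (1)).  THEOREMS ONLY: no `def`, no `instance`, no `notation`, no named-fact
hypothesis, no `sorry`, NO `Lines` import; default heartbeats except where measured.  CLOSES NO SOCKET: the (M) socket of FILE B
`Cruxes/H413/Lines/R90_S8_ResidualSpectrumU3B.lean` ED. 7 :299 keeps its `sorry`; this file is its OF-LETTERS head.

## THE SOCKET FRAME (B ED. 7 :299–:322, quoted)
`∀ (L) … (μ : Measure (quasiSplit L⁺ L c 3).automorphicQuotient) [IsAutomorphicMeasure μ] (μω) (hμu : μω.IsUnitary), (μω ∘ ideleBaseChange = quadraticHeckeCharCM L) →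
∀ (ξ : OneDimAutRepH L) (P′ : DiscreteAutomorphicRep (quasiSplit …) μ), P′.space ≤ resGMidBlock L μ ξ μω → ∃ Pv, ξ.IsXiLocalFamily hH hHd μω hμu Pv ∧ LocalConstituentsIn P′ Pv ∧
∀ v NON-SPLIT, ∀ c ∈ (Pv v).members, ¬ c.IsSupercuspidal ∧ ∀ [MeasurableSpace (G_v ⧸ Z(G_v))] [BorelSpace …] (μZ) [μZ.IsHaarMeasure], ¬ c.IsSquareIntegrable μZ`
with `hH := UnitaryGroup.cmConj_antidiagonal_transpose L 3`, `hHd := (Matrix.isUnit_iff_isUnit_det _).mp (StdForm.isUnit_over (StdForm.antidiagonal 3) L)`; there is NO parabolic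
datum and NO separate irreducibility hypothesis (irreducibility is inside ★ `DiscreteAutomorphicRep`).  The Haar binders of clause (3) live on the H-SIDE quotient
`(quasiSplit …).Local v ⧸ Z` (H = `(StdForm.antidiagonal 3).over L`, which is NOT the literal `qsForm L` as bytes), while ★ Keys (`KeysCaseTwoLabels`, ★ `keysCaseTwo_holds`,
the rigidity ★ `keysLabelsCM_isSquareIntegrable_of_isHaarMeasure`) lives on the MODEL `Gqs L v ⧸ Z`; a D6 frame `e = cmDatumLocalCongr L v T ha h : Gqs L v ≃ₜ* U(H)(L⁺_v)` sits
in between, exactly as in ★ D6's non-split clause.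

## CONTENTS (namespace `Summit.HodgeConjecture.HodgeConjecture.R90.S8`)
* §1 GENERIC TRANSPORT (the one new piece of mathematics, [BushnellHenniart2006 §10.1] names the notion; transport is folklore): for an isomorphism of topological groups
  `e : G′ ≃ₜ* G` there is `τ : G′ ⧸ Z(G′) ≃ₜ* G ⧸ Z(G)` with `τ ∘ mk = mk ∘ e` (`exists_quotientCenterCongr`, Mathlib `QuotientGroup.congr`); square-integrability modulo the
  centre of `ρ ∘ e` for `μ′` gives that of `ρ` for `μ′.map τ` (`isSquareIntegrableModCenter_map_of_comp`; ★ `Representation.mem_contragredient_comp_iff`, Mathlib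
  `MeasurableEquiv.memLp_map_measure_iff`), hence at class level `irrClass_isSquareIntegrable_map_of_comap`; and `μ′.map τ` is a HAAR measure (Mathlib
  `ContinuousMulEquiv.isHaarMeasure_map`), so «`¬ L²` for EVERY Haar measure on `G ⧸ Z(G)`» transports to «`¬ L²` for EVERY Haar measure on `G′ ⧸ Z(G′)`» for `comap e c`
  (`irrClass_not_isSquareIntegrable_comap_of_forall`) — no Haar uniqueness and no `LocallyCompactSpace` instance are used.
* §2 THE HEAD `res_middleResidue_isPiN_of_letters`: the socket frame with `hP′le` REPLACED by two block-free letters on `P′` — (ISO) at every NON-SPLIT `v`: along some frame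
  `e`, ONE class `x` of the model that is a constituent of `i_G(χ_{ξ,v})`, NOT supercuspidal, NOT square-integrable for ANY Haar measure on the model, and such that EVERY
  `v`-constituent of `P′` is `x ∘ e⁻¹` [§12.2 (2)–(3) pp. 173–174: `πⁿ(ξ_v)` = the non-square-integrable constituent of `i_G(χ_ξ)`]; (SPLIT) at every SPLIT `v`: every
  `v`-constituent of `P′` is a member of ★ D6's split packet `cmSplitPacket …` at the fixed witness [§13.3 p. 201; Lemma 4.13.1 (b)] — conclusion = the socket's ∃-body
  byte for byte; spine = ★ `R90S5MemXiFamilyOfPinnedConstituents.memXiFamily_of_pinnedAt` :95–:122 (`choose` over a per-place packet, no `dite`).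
* §3 (M-e) OVER ★ KEYS, hypothesis-free over ★ `keysCaseTwo_holds`: `isoLetter_of_keysLabels` — at a non-split `v`, a frame, Keys labels `(π², πⁿ)` of `i_G(χ_{ξ,v})` with
  `πⁿ` not `L²` at ONE Haar measure `μZ₀` of the model, and the dealer's weak pin «for every `v`-constituent `c` of `P′`, `comap e c` is a constituent of `i_G(χ_{ξ,v})` that
  is not `L²` at `μZ₀`» give the (ISO)_v body with `x := πⁿ` — ONE class per non-split place comes free from Keys (`comap e c ∈ {πⁿ, π²}` and `π²` IS `L²`, ★
  `isSquareIntegrable_pi2_of_keysLabels`), `¬ L²` for every Haar measure by ★ rigidity, `¬` supercuspidal by ★ `not_isSupercuspidal_of_not_isSquareIntegrable_gqs`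
  (the strong pin «every `v`-constituent IS `πⁿ ∘ e⁻¹`» is the special case `hcon := …` recorded in its docstring).

VISIBLE LETTERS after this file (g5 census f283641be139b1c0, minus ADM (M-f)(i) which this road no longer needs): per non-split `v` the (ISO) pin ⟸ ORIENT (M-c) + RES-INT
(M-a) + FACT-N (M-b) + ESTATE T `hEXPτ` + `hW1` + the isotypic algebra (M-f)(ii); per split `v` the (SPLIT) pin ⟸ SPLIT-LQ (M-d) + the same globals.

HONEST LABEL: HC_CM is proved only modulo the 7 printed citations (2 remaining named inputs: hLiu418 = `stmt-HodgeConjecture-24832`, h413 = `stmt-HodgeConjecture-24833`) until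
rung 0 closes; an OF-LETTERS head pays nothing by itself — (M) :299 stays `sorry`; REL ≠ ★ ≠ BUILT; count-neutral.

## References
* [Rogawski1990] J. D. Rogawski, *Automorphic Representations of Unitary Groups in Three Variables*, Ann. of Math. Stud. 123 (1990), §4.13 p. 62 Lemma 4.13.1 (b); §12.2
  (2)–(3) pp. 172–174; §13.1 p. 199, Prop. 13.1.3 (d); §13.3 p. 201; §13.9 (ii) p. 229; §14.2 p. 232.
* [Keys1984] D. Keys, *Principal series representations of special unitary groups over local fields*, Compositio Math. 51 (1984), §7 Thm. p. 126.
* [BushnellHenniart2006] C. J. Bushnell, G. Henniart, *The Local Langlands Conjecture for GL(2)*, Grundlehren 335 (2006), §1.1, §2.8, §10.1.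
* [MoeglinWaldspurger1995] C. Mœglin, J.-L. Waldspurger, *Spectral Decomposition and Eisenstein Series* (1995), IV.1.11, V.3.13.
-/

set_option autoImplicit false
-- the mandated namespace repeats the single-problem summit's segment (`HodgeConjecture.HodgeConjecture`)
set_option linter.dupNamespace false

noncomputable section

open MeasureTheory NumberField IsDedekindDomain
open scoped Matrix
open Literature.NumberTheory.GaloisRepresentations Literature.NumberTheory.Automorphic.Arthur2013.Leaves.TECR
open Literature.NumberTheory.Automorphic Literature.NumberTheory.Automorphic.UnitaryGroup Literature.NumberTheory.Rogawski1990

namespace Summit.HodgeConjecture.HodgeConjecture.R90.S8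

/-! ## §1 Generic transport: square-integrability modulo the centre along an isomorphism of topological groups [BushnellHenniart2006 §10.1] -/

section Transport

variable {G G' : Type} [Group G] [TopologicalSpace G] [IsTopologicalGroup G] [Group G'] [TopologicalSpace G'] [IsTopologicalGroup G']

/-- An isomorphism of groups carries the centre onto the centre: `θ(Z(G′)) = Z(G)`. [cite: BushnellHenniart2006, §1.1] -/
theorem map_center_eq_center {M M' : Type*} [Group M] [Group M'] (θ : M' ≃* M) : (Subgroup.center M').map (θ : M' →* M) = Subgroup.center M := by
  ext g
  simp only [Subgroup.mem_map, Subgroup.mem_center_iff, MonoidHom.coe_coe]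
  constructor
  · rintro ⟨g', hg', rfl⟩ x
    obtain ⟨x', rfl⟩ := θ.surjective x
    rw [← map_mul, ← map_mul, hg' x']
  · intro hg
    refine ⟨θ.symm g, fun x' => θ.injective ?_, θ.apply_symm_apply g⟩
    rw [map_mul, map_mul, θ.apply_symm_apply]
    exact hg (θ x')

omit [IsTopologicalGroup G] [IsTopologicalGroup G'] in
/-- **The quotient-by-centre congruence `τ : G′ ⧸ Z(G′) ≃ₜ* G ⧸ Z(G)` along `e : G′ ≃ₜ* G`**, `τ (mk g′) = mk (e g′)` (Mathlib `QuotientGroup.congr` at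
`map_center_eq_center`; continuity both ways through the open quotient maps, the pattern of ★ `K2LiuQuotientMeasureTransport.exists_quotientHomeomorph`).
[cite: BushnellHenniart2006, §10.1] -/
theorem exists_quotientCenterCongr (e : G' ≃ₜ* G) :
    ∃ τ : G' ⧸ Subgroup.center G' ≃ₜ* G ⧸ Subgroup.center G, ∀ g' : G', τ (QuotientGroup.mk g') = QuotientGroup.mk (e g') := by
  let eq := QuotientGroup.congr (Subgroup.center G') (Subgroup.center G) e.toMulEquiv (map_center_eq_center e.toMulEquiv)
  have heq_mk : ∀ u : G', eq (QuotientGroup.mk u) = QuotientGroup.mk (e u) := fun u =>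
    QuotientGroup.congr_mk (Subgroup.center G') (Subgroup.center G) e.toMulEquiv (map_center_eq_center e.toMulEquiv) u
  have heq_symm_mk : ∀ w : G, eq.symm (QuotientGroup.mk w) = QuotientGroup.mk (e.symm w) := fun w => by
    rw [MulEquiv.symm_apply_eq, heq_mk]
    exact congrArg QuotientGroup.mk (e.apply_symm_apply w).symm
  have hceq : Continuous eq := by
    rw [(QuotientGroup.isQuotientMap_mk _).continuous_iff]
    have hc : (eq : _ → _) ∘ QuotientGroup.mk = QuotientGroup.mk ∘ e := funext heq_mk
    rw [hc]
    exact continuous_quotient_mk'.comp e.continuous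
  have hceq' : Continuous eq.symm := by
    rw [(QuotientGroup.isQuotientMap_mk _).continuous_iff]
    have hc : (eq.symm : _ → _) ∘ QuotientGroup.mk = QuotientGroup.mk ∘ e.symm := funext heq_symm_mk
    rw [hc]
    exact continuous_quotient_mk'.comp e.symm.continuous
  exact ⟨{ eq with continuous_toFun := hceq, continuous_invFun := hceq' }, heq_mk⟩

/-- **Square-integrability modulo the centre transports along `e : G′ ≃ₜ* G`** (representation level): if `ρ ∘ e` is square-integrable modulo `Z(G′)` for a measure `μ′` on
`G′ ⧸ Z(G′)`, then `ρ` is square-integrable modulo `Z(G)` for the pushed-forward measure `μ′.map τ` — the smooth contragredients of `ρ` and `ρ ∘ e` coincide (★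
`Representation.mem_contragredient_comp_iff`), the matrix coefficients are `c_{φ,w}(ρ)(e g′) = c_{φ,w}(ρ ∘ e)(g′)`, and a dominating `L²(μ′)` function `f` gives the dominating
`L²(μ′.map τ)` function `f ∘ τ⁻¹` (Mathlib `MeasurableEquiv.memLp_map_measure_iff`). [cite: BushnellHenniart2006, §10.1] -/
theorem isSquareIntegrableModCenter_map_of_comp (e : G' ≃ₜ* G) {V : Type*} [AddCommGroup V] [Module ℂ V] (ρ : Representation ℂ G V)
    [MeasurableSpace (G ⧸ Subgroup.center G)] [BorelSpace (G ⧸ Subgroup.center G)]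
    [MeasurableSpace (G' ⧸ Subgroup.center G')] [BorelSpace (G' ⧸ Subgroup.center G')]
    (τ : G' ⧸ Subgroup.center G' ≃ₜ* G ⧸ Subgroup.center G) (hτ : ∀ g' : G', τ (QuotientGroup.mk g') = QuotientGroup.mk (e g'))
    (μ' : Measure (G' ⧸ Subgroup.center G')) (h : Representation.IsSquareIntegrableModCenter (ρ.comp (e : G' →* G)) μ') :
    ρ.IsSquareIntegrableModCenter (μ'.map τ) := by
  intro φ hφ w
  obtain ⟨f, hf, hdom⟩ := h φ ((Representation.mem_contragredient_comp_iff ρ e φ).2 hφ) w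
  refine ⟨f ∘ τ.symm, ?_, fun g => ?_⟩
  · -- `f ∘ τ⁻¹ ∈ L²(μ′.map τ)` because `(f ∘ τ⁻¹) ∘ τ = f ∈ L²(μ′)`
    have hcoe : (τ : G' ⧸ Subgroup.center G' → G ⧸ Subgroup.center G) = τ.toHomeomorph.toMeasurableEquiv := by
      rw [Homeomorph.toMeasurableEquiv_coe]
      rfl
    rw [hcoe, MeasurableEquiv.memLp_map_measure_iff]
    have hcomp : (f ∘ τ.symm) ∘ (τ.toHomeomorph.toMeasurableEquiv : G' ⧸ Subgroup.center G' → G ⧸ Subgroup.center G) = f := by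
      funext q
      rw [← hcoe]
      simp only [Function.comp_apply, ContinuousMulEquiv.symm_apply_apply]
    rw [hcomp]
    exact hf
  · -- domination at `g = e (e⁻¹ g)`
    have hq : τ.symm (QuotientGroup.mk g : G ⧸ Subgroup.center G) = QuotientGroup.mk (e.symm g) := by
      rw [ContinuousMulEquiv.symm_apply_eq, hτ, ContinuousMulEquiv.apply_symm_apply]
    have hcoeff : ρ.matrixCoeff φ w g = Representation.matrixCoeff (ρ.comp (e : G' →* G)) φ w (e.symm g) := by
      simp only [Representation.matrixCoeff_apply, MonoidHom.coe_comp, Function.comp_apply, MonoidHom.coe_coe,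
        ContinuousMulEquiv.apply_symm_apply]
    rw [hcoeff, Function.comp_apply, hq]
    exact hdom (e.symm g)

/-- **Square-integrability of CLASSES transports along ★ `IrrClass.comap e`**: `(comap e c).IsSquareIntegrable μ′ → c.IsSquareIntegrable (μ′.map τ)` (★
`IrrClass.isSquareIntegrable_mk_iff` pins the predicate to representatives; `comap e ⟦r⟧ = ⟦r ∘ e⟧`, ★ `IrrClass.comap_mk`, `SmoothIrrep.comap_ρ`).
[cite: BushnellHenniart2006, §10.1] [cite: Rogawski1990, §12.2 (2) pp. 173–174] -/
theorem irrClass_isSquareIntegrable_map_of_comap (e : G' ≃ₜ* G) (c : IrrClass G)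
    [MeasurableSpace (G ⧸ Subgroup.center G)] [BorelSpace (G ⧸ Subgroup.center G)]
    [MeasurableSpace (G' ⧸ Subgroup.center G')] [BorelSpace (G' ⧸ Subgroup.center G')]
    (τ : G' ⧸ Subgroup.center G' ≃ₜ* G ⧸ Subgroup.center G) (hτ : ∀ g' : G', τ (QuotientGroup.mk g') = QuotientGroup.mk (e g'))
    (μ' : Measure (G' ⧸ Subgroup.center G')) (h : (IrrClass.comap e c).IsSquareIntegrable μ') :
    c.IsSquareIntegrable (μ'.map τ) := by
  induction c using IrrClass.ind with
  | h r =>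
    rw [IrrClass.comap_mk, IrrClass.isSquareIntegrable_mk_iff, SmoothIrrep.comap_ρ] at h
    exact IrrClass.isSquareIntegrable_mk _ r (isSquareIntegrableModCenter_map_of_comp e r.ρ τ hτ μ' h)

/-- **«NOT `L²` for EVERY Haar measure» transports along ★ `IrrClass.comap e`**: if `c` is square-integrable for NO Haar measure on `G ⧸ Z(G)` (any Borel structure), then
`comap e c` is square-integrable for no Haar measure on `G′ ⧸ Z(G′)` — the push-forward `μ′.map τ` of a Haar measure along the topological-group isomorphism `τ` is a Haar
measure (Mathlib `ContinuousMulEquiv.isHaarMeasure_map`).  No Haar uniqueness is used. [cite: BushnellHenniart2006, §10.1] [cite: Rogawski1990, §12.2 (2) pp. 173–174] -/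
theorem irrClass_not_isSquareIntegrable_comap_of_forall (e : G' ≃ₜ* G) (c : IrrClass G)
    (hc : ∀ [MeasurableSpace (G ⧸ Subgroup.center G)] [BorelSpace (G ⧸ Subgroup.center G)]
      (μ : Measure (G ⧸ Subgroup.center G)) [μ.IsHaarMeasure], ¬ c.IsSquareIntegrable μ)
    [MeasurableSpace (G' ⧸ Subgroup.center G')] [BorelSpace (G' ⧸ Subgroup.center G')]
    (μ' : Measure (G' ⧸ Subgroup.center G')) [μ'.IsHaarMeasure] :
    ¬ (IrrClass.comap e c).IsSquareIntegrable μ' := by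
  intro h
  borelize (G ⧸ Subgroup.center G)
  obtain ⟨τ, hτ⟩ := exists_quotientCenterCongr e
  exact hc (μ'.map τ) (irrClass_isSquareIntegrable_map_of_comap e c τ hτ μ' h)

end Transport

/-! ## §2 The head: (M) :299 from the per-place pins [Rogawski1990 §12.2 (2)–(3) pp. 173–174; §13.1 p. 199; §13.3 p. 201; §13.9 (ii) p. 229] -/

section Head

variable (L : Type) [Field L] [NumberField L] [IsCMField L]

set_option maxHeartbeats 800000 in -- measured: the statement spells ★ `cmPrincipalSeries` and ★ `cmSplitPacket` (≈ 40k heartbeats each to elaborate, cf. ★ `F0P3XiLocalFamilyOfRecord`)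
/-- **(M) :299 OF LETTERS — `res_middleResidue_isPiN_of_letters`.**  The frame of FILE B ED. 7 :299 `sock_S8_res_middleResidue_isPiN` (`(L μ μω hμu) (hμω) (ξ) (P′)`) with its
hypothesis `hP′le : P′.space ≤ resGMidBlock L μ ξ μω` REPLACED by two block-free per-place pins on the irreducible `P′` (the middle block enters only through their payer):
* (SPLIT) `hSPLIT`: at a place `v` SPLIT in `L`, every `v`-constituent of `P′` (D6 currency: ★ `LocalConstituentsIn`'s clause) is a member of ★ D6's split packet
  `cmSplitPacket …` of `ξ` at the fixed witness `splitWitness v hs` [§13.3 p. 201 «an L-packet consists of a single irreducible representation»; Lemma 4.13.1 (b)];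
* (ISO) `hISO`: at a NON-SPLIT `v`, along some form congruence `e = cmDatumLocalCongr L v T ha h : U(Φ₃)(L⁺_v) ≃ₜ* U(H)(L⁺_v)` (★ D6's (O1) identification), ONE class `x` of the
  model `U(Φ₃)(L⁺_v)` which is a constituent of `i_G(χ_{ξ,v})` (★ `cmPrincipalSeries … (cmXiTorusChar …)`), NOT supercuspidal, NOT square-integrable modulo the centre for ANY
  Haar measure on the model, and such that EVERY `v`-constituent of `P′` is `x ∘ e⁻¹` — i.e. «`π_v = πⁿ(ξ_v)`», `πⁿ(ξ_v)` = the non-square-integrable constituent of the length-two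
  `i_G(χ_ξ)` [§12.2 (2) p. 174, (3) p. 173].
CONCLUSION = the socket's ∃-body BYTE FOR BYTE: a family `Pv` with ★ `ξ.IsXiLocalFamily hH hHd μω hμu Pv`, ★ `LocalConstituentsIn P′ Pv`, and at every non-split `v` all members
non-supercuspidal and square-integrable for no Haar measure on the H-side quotient.  PROOF: `Pv v :=` the split packet ∕ `⟨x ∘ e⁻¹, none⟩` (the `choose` spine of ★
`memXiFamily_of_pinnedAt`); clause (3): members `= {x ∘ e⁻¹}` (★ `LocalAPacket.mem_members_iff`), `¬` supercuspidal by ★ `IrrClass.isSupercuspidal_comap_iff`, `¬ L²` on the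
H-side for every Haar measure by §1 `irrClass_not_isSquareIntegrable_comap_of_forall`.  The unused frame tokens `μ`-automorphy and `hμω` are kept so that the payer's term is
`res_middleResidue_isPiN_of_letters L μ μω hμu hμω ξ P′ hSPLIT hISO` at the socket's binders.
[cite: Rogawski1990, §12.2 (2)–(3) pp. 173–174; §13.9 (ii) p. 229; §13.1 p. 199; §13.3 p. 201; §14.2 p. 232] [cite: Keys1984, §7 Thm. p. 126] -/
theorem res_middleResidue_isPiN_of_letters
    (μ : Measure (quasiSplit (↥(maximalRealSubfield L)) L (IsCMField.complexConj L) 3).automorphicQuotient)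
    [(quasiSplit (↥(maximalRealSubfield L)) L (IsCMField.complexConj L) 3).IsAutomorphicMeasure μ]
    (μω : HeckeCharacter L) (hμu : μω.IsUnitary)
    (_hμω : ∀ x : Literature.NumberTheory.GaloisRepresentations.ideleGroup ↥(maximalRealSubfield L),
      μω (AdeleRing.ideleBaseChange (↥(maximalRealSubfield L)) L x) = quadraticHeckeCharCM L x)
    (ξ : OneDimAutRepH L) (P' : DiscreteAutomorphicRep (quasiSplit (↥(maximalRealSubfield L)) L (IsCMField.complexConj L) 3) μ)
    (hSPLIT : ∀ (v : HeightOneSpectrum (𝓞 ↥(maximalRealSubfield L))) (hs : ∃ w : PlacesOver L v, IsCMField.complexConj L • w.1 ≠ w.1)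
      (c : IrrClass ((quasiSplit (↥(maximalRealSubfield L)) L (IsCMField.complexConj L) 3).Local v)),
      (IrrClass.comap (localPiEquiv L (IsCMField.complexConj L) 3 ((StdForm.antidiagonal 3).over L) v) c).IsConstituentOf
          (P'.finRep.smoothPart.toRepresentation.comp
            (inclPlace (↥(maximalRealSubfield L)) L (IsCMField.complexConj L) 3 ((StdForm.antidiagonal 3).over L) v)) →
        c ∈ (cmSplitPacket L ((StdForm.antidiagonal 3).over L) (UnitaryGroup.cmConj_antidiagonal_transpose L 3)
          ((Matrix.isUnit_iff_isUnit_det _).mp (StdForm.isUnit_over (StdForm.antidiagonal 3) L)) v (splitWitness v hs) (splitWitness_spec v hs)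
          (ξ.splitν₀ μω (splitWitness v hs).1) (ξ.locψ (splitWitness v hs).1) (ξ.norm_splitν₀_apply hμu (splitWitness v hs).1)
          (ξ.continuous_splitν₀ μω (splitWitness v hs).1) (ξ.norm_locψ_apply (splitWitness v hs).1)
          (ξ.continuous_locψ (splitWitness v hs).1)).members)
    (hISO : ∀ (v : HeightOneSpectrum (𝓞 ↥(maximalRealSubfield L))), (∀ w : PlacesOver L v, IsCMField.complexConj L • w.1 = w.1) →
      ∃ (T : GL (Fin 3) (LocalRing L v)) (a : LocalRing L v) (ha : IsUnit a)
        (h : formCongr (conjLocal L (IsCMField.complexConj L) v) T (((StdForm.antidiagonal 3).over L).map (algebraMap L (LocalRing L v))) =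
          a • (Matrix.of fun i j : Fin 3 => if i.val + j.val + 1 = 3 then (1 : L) else 0).map (algebraMap L (LocalRing L v)))
        (x : IrrClass (Gqs L v)),
        x.IsConstituentOf (cmPrincipalSeries L 3 v (cmXiTorusChar L v (μω.semilocalComponent L v)
          (torusLocalComponent L (IsCMField.complexConj L) v ξ.η) (torusLocalComponent L (IsCMField.complexConj L) v ξ.ψ))) ∧
        ¬ x.IsSupercuspidal ∧
        (∀ [MeasurableSpace (Gqs L v ⧸ Subgroup.center (Gqs L v))] [BorelSpace (Gqs L v ⧸ Subgroup.center (Gqs L v))]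
            (μZ : Measure (Gqs L v ⧸ Subgroup.center (Gqs L v))) [μZ.IsHaarMeasure], ¬ x.IsSquareIntegrable μZ) ∧
        ∀ c : IrrClass ((quasiSplit (↥(maximalRealSubfield L)) L (IsCMField.complexConj L) 3).Local v),
          (IrrClass.comap (localPiEquiv L (IsCMField.complexConj L) 3 ((StdForm.antidiagonal 3).over L) v) c).IsConstituentOf
              (P'.finRep.smoothPart.toRepresentation.comp
                (inclPlace (↥(maximalRealSubfield L)) L (IsCMField.complexConj L) 3 ((StdForm.antidiagonal 3).over L) v)) →
            c = IrrClass.comap (cmDatumLocalCongr L v T ha h).symm x) :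
    ∃ Pv : ∀ v : HeightOneSpectrum (𝓞 ↥(maximalRealSubfield L)), CMLocalAPacket L ((StdForm.antidiagonal 3).over L) v,
      ξ.IsXiLocalFamily (UnitaryGroup.cmConj_antidiagonal_transpose L 3)
          ((Matrix.isUnit_iff_isUnit_det _).mp (StdForm.isUnit_over (StdForm.antidiagonal 3) L)) μω hμu Pv ∧
      LocalConstituentsIn P' Pv ∧
      ∀ v : HeightOneSpectrum (𝓞 ↥(maximalRealSubfield L)),
        (∀ w : PlacesOver L v, IsCMField.complexConj L • w.1 = w.1) →
        ∀ c : IrrClass ((quasiSplit (↥(maximalRealSubfield L)) L (IsCMField.complexConj L) 3).Local v), c ∈ (Pv v).members →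
          ¬ c.IsSupercuspidal ∧
          ∀ [MeasurableSpace ((quasiSplit (↥(maximalRealSubfield L)) L (IsCMField.complexConj L) 3).Local v ⧸
                Subgroup.center ((quasiSplit (↥(maximalRealSubfield L)) L (IsCMField.complexConj L) 3).Local v))]
            [BorelSpace ((quasiSplit (↥(maximalRealSubfield L)) L (IsCMField.complexConj L) 3).Local v ⧸
                Subgroup.center ((quasiSplit (↥(maximalRealSubfield L)) L (IsCMField.complexConj L) 3).Local v))]
            (μZ : Measure ((quasiSplit (↥(maximalRealSubfield L)) L (IsCMField.complexConj L) 3).Local v ⧸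
                Subgroup.center ((quasiSplit (↥(maximalRealSubfield L)) L (IsCMField.complexConj L) 3).Local v)))
            [μZ.IsHaarMeasure], ¬ c.IsSquareIntegrable μZ := by
  -- place by place, ONE packet carrying the four clauses (split equation ∕ non-split pin ∕ membership ∕ non-split labels); NO `dite` (kernel-light)
  have hfam : ∀ v : HeightOneSpectrum (𝓞 ↥(maximalRealSubfield L)), ∃ p : CMLocalAPacket L ((StdForm.antidiagonal 3).over L) v,
      (∀ hs : ∃ w : PlacesOver L v, IsCMField.complexConj L • w.1 ≠ w.1,
        p = cmSplitPacket L ((StdForm.antidiagonal 3).over L) (UnitaryGroup.cmConj_antidiagonal_transpose L 3)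
          ((Matrix.isUnit_iff_isUnit_det _).mp (StdForm.isUnit_over (StdForm.antidiagonal 3) L)) v (splitWitness v hs) (splitWitness_spec v hs)
          (ξ.splitν₀ μω (splitWitness v hs).1) (ξ.locψ (splitWitness v hs).1) (ξ.norm_splitν₀_apply hμu (splitWitness v hs).1)
          (ξ.continuous_splitν₀ μω (splitWitness v hs).1) (ξ.norm_locψ_apply (splitWitness v hs).1)
          (ξ.continuous_locψ (splitWitness v hs).1)) ∧
      ((∀ w : PlacesOver L v, IsCMField.complexConj L • w.1 = w.1) →
        ∃ (T : GL (Fin 3) (LocalRing L v)) (a : LocalRing L v) (ha : IsUnit a)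
          (h : formCongr (conjLocal L (IsCMField.complexConj L) v) T (((StdForm.antidiagonal 3).over L).map (algebraMap L (LocalRing L v))) =
            a • (Matrix.of fun i j : Fin 3 => if i.val + j.val + 1 = 3 then (1 : L) else 0).map (algebraMap L (LocalRing L v)))
          (x : IrrClass (Gqs L v)) (s : Option (IrrClass ((cmDatum L 3 ((StdForm.antidiagonal 3).over L)).Local v))),
          p = ⟨IrrClass.comap (cmDatumLocalCongr L v T ha h).symm x, s⟩ ∧
          x.IsConstituentOf (cmPrincipalSeries L 3 v (cmXiTorusChar L v (μω.semilocalComponent L v)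
            (torusLocalComponent L (IsCMField.complexConj L) v ξ.η) (torusLocalComponent L (IsCMField.complexConj L) v ξ.ψ))) ∧
          ∀ c : IrrClass ((cmDatum L 3 ((StdForm.antidiagonal 3).over L)).Local v), s = some c → c.IsSupercuspidal) ∧
      (∀ c : IrrClass ((quasiSplit (↥(maximalRealSubfield L)) L (IsCMField.complexConj L) 3).Local v),
        (IrrClass.comap (localPiEquiv L (IsCMField.complexConj L) 3 ((StdForm.antidiagonal 3).over L) v) c).IsConstituentOf
            (P'.finRep.smoothPart.toRepresentation.comp
              (inclPlace (↥(maximalRealSubfield L)) L (IsCMField.complexConj L) 3 ((StdForm.antidiagonal 3).over L) v)) →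
          c ∈ p.members) ∧
      ((∀ w : PlacesOver L v, IsCMField.complexConj L • w.1 = w.1) →
        ∀ c : IrrClass ((quasiSplit (↥(maximalRealSubfield L)) L (IsCMField.complexConj L) 3).Local v), c ∈ p.members →
          ¬ c.IsSupercuspidal ∧
          ∀ [MeasurableSpace ((quasiSplit (↥(maximalRealSubfield L)) L (IsCMField.complexConj L) 3).Local v ⧸
                Subgroup.center ((quasiSplit (↥(maximalRealSubfield L)) L (IsCMField.complexConj L) 3).Local v))]
            [BorelSpace ((quasiSplit (↥(maximalRealSubfield L)) L (IsCMField.complexConj L) 3).Local v ⧸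
                Subgroup.center ((quasiSplit (↥(maximalRealSubfield L)) L (IsCMField.complexConj L) 3).Local v))]
            (μZ : Measure ((quasiSplit (↥(maximalRealSubfield L)) L (IsCMField.complexConj L) 3).Local v ⧸
                Subgroup.center ((quasiSplit (↥(maximalRealSubfield L)) L (IsCMField.complexConj L) 3).Local v)))
            [μZ.IsHaarMeasure], ¬ c.IsSquareIntegrable μZ) := by
    intro v
    by_cases hs₀ : ∃ w : PlacesOver L v, IsCMField.complexConj L • w.1 ≠ w.1
    · -- SPLIT place: the split packet at the fixed witness; the two non-split clauses are vacuous
      refine ⟨cmSplitPacket L ((StdForm.antidiagonal 3).over L) (UnitaryGroup.cmConj_antidiagonal_transpose L 3)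
          ((Matrix.isUnit_iff_isUnit_det _).mp (StdForm.isUnit_over (StdForm.antidiagonal 3) L)) v (splitWitness v hs₀) (splitWitness_spec v hs₀)
          (ξ.splitν₀ μω (splitWitness v hs₀).1) (ξ.locψ (splitWitness v hs₀).1) (ξ.norm_splitν₀_apply hμu (splitWitness v hs₀).1)
          (ξ.continuous_splitν₀ μω (splitWitness v hs₀).1) (ξ.norm_locψ_apply (splitWitness v hs₀).1)
          (ξ.continuous_locψ (splitWitness v hs₀).1), fun _ => rfl, fun hns => ?_, fun c hc => hSPLIT v hs₀ c hc, fun hns => ?_⟩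
      · obtain ⟨w, hw⟩ := hs₀
        exact absurd (hns w) hw
      · obtain ⟨w, hw⟩ := hs₀
        exact absurd (hns w) hw
    · -- NON-SPLIT place: the pinned pair `⟨x ∘ e⁻¹, none⟩`
      have hns : ∀ w : PlacesOver L v, IsCMField.complexConj L • w.1 = w.1 := fun w => not_not.1 fun hw => hs₀ ⟨w, hw⟩
      obtain ⟨T, a, ha, h, x, hx, hxsc, hxL2, hpin⟩ := hISO v hns
      refine ⟨⟨IrrClass.comap (cmDatumLocalCongr L v T ha h).symm x, none⟩, fun hs => absurd hs hs₀,
        fun _ => ⟨T, a, ha, h, x, none, rfl, hx, fun c hc => absurd hc.symm (Option.some_ne_none c)⟩,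
        fun c hc => (LocalAPacket.mem_members_iff _ c).2 (Or.inl (hpin c hc)), fun _ c hc => ?_⟩
      -- the only member is `x ∘ e⁻¹`
      have hcx : c = IrrClass.comap (cmDatumLocalCongr L v T ha h).symm x := by
        rcases (LocalAPacket.mem_members_iff _ c).1 hc with hc' | hc'
        · exact hc'
        · exact absurd hc'.symm (Option.some_ne_none c)
      subst hcx
      refine ⟨fun hsc => hxsc ((IrrClass.isSupercuspidal_comap_iff (cmDatumLocalCongr L v T ha h).symm x).1 hsc), ?_⟩
      intro mZ bZ μZ hμZ
      exact @irrClass_not_isSquareIntegrable_comap_of_forall _ _ _ _ _ _ _ _ (cmDatumLocalCongr L v T ha h).symm x hxL2 mZ bZ μZ hμZ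
  choose Pv hPv using hfam
  exact ⟨Pv, ⟨fun v hs => (hPv v).1 hs, fun v hns => (hPv v).2.1 hns⟩, fun v c hc => (hPv v).2.2.1 c hc, fun v hns c hc => (hPv v).2.2.2 hns c hc⟩

end Head

/-! ## §3 (M-e) The non-split pin from ★ Keys labels [Rogawski1990 §12.2 (2) pp. 173–174; Keys1984 §7] -/

section Keys

variable (L : Type) [Field L] [NumberField L] [IsCMField L]

set_option maxHeartbeats 800000 in -- measured: the statement spells ★ `cmPrincipalSeries` through ★ `KeysCaseTwoLabels` and twice more (≈ 40k heartbeats each)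
/-- **(M-e) `isoLetter_of_keysLabels` — the (ISO)_v pin of `res_middleResidue_isPiN_of_letters` FROM KEYS LABELS AND ONE HAAR MEASURE.**  At a NON-SPLIT `v`, let a form
congruence `e = cmDatumLocalCongr L v T ha h`, Keys labels `(π², πⁿ)` of `i_G(χ_{ξ,v})` (★ `KeysCaseTwoLabels` at `(μω_v, η_v, ψ_v)`) and ONE Haar measure `μZ₀` on the model quotient
with `πⁿ` NOT square-integrable for `μZ₀` be given, together with the weak pin «for every `v`-constituent `c` of `P′`, `comap e c` is a constituent of `i_G(χ_{ξ,v})` that is NOT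
square-integrable for `μZ₀`».  Then the (ISO)_v body holds with `x := πⁿ`: `comap e c ∈ {πⁿ, π²}` and `π²` IS square-integrable for `μZ₀` (★ `isSquareIntegrable_pi2_of_keysLabels`,
over ★ `keysCaseTwo_holds`), so `comap e c = πⁿ` and `c = πⁿ ∘ e⁻¹` (★ `IrrClass.comap_symm_comap`) — ONE class per non-split place comes free from Keys; `πⁿ` is not `L²` for ANY
Haar measure on ANY Borel structure (★ rigidity `keysLabelsCM_isSquareIntegrable_of_isHaarMeasure`, Borel structures being unique) and not supercuspidal (compact centre at the
non-split `v`, ★ `not_isSupercuspidal_of_not_isSquareIntegrable_gqs`).  `μω|_{𝕀_{L⁺}} = ω_{L∕L⁺}` (`hμω`) makes `μω_v` a quadratic-character extension, the hypothesis of Keys' case (2).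
STRONG-PIN use: when the payer knows «every `v`-constituent `c` IS `πⁿ ∘ e⁻¹`» (`hpin c hc : c = comap e⁻¹ πn`), feed `hcon := fun c hc => by rw [hpin c hc, IrrClass.comap_comap_symm]; exact
⟨(hK.2 πn).2 (Or.inl rfl), hn⟩`. [cite: Rogawski1990, §12.2 (2)–(3) pp. 173–174] [cite: Keys1984, §7 Thm. p. 126] -/
theorem isoLetter_of_keysLabels (μω : HeckeCharacter L)
    (hμω : ∀ x : Literature.NumberTheory.GaloisRepresentations.ideleGroup ↥(maximalRealSubfield L),
      μω (AdeleRing.ideleBaseChange (↥(maximalRealSubfield L)) L x) = quadraticHeckeCharCM L x)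
    (ξ : OneDimAutRepH L) {v : HeightOneSpectrum (𝓞 ↥(maximalRealSubfield L))}
    (hns : ∀ w : PlacesOver L v, IsCMField.complexConj L • w.1 = w.1)
    (T : GL (Fin 3) (LocalRing L v)) (a : LocalRing L v) (ha : IsUnit a)
    (h : formCongr (conjLocal L (IsCMField.complexConj L) v) T (((StdForm.antidiagonal 3).over L).map (algebraMap L (LocalRing L v))) =
      a • (Matrix.of fun i j : Fin 3 => if i.val + j.val + 1 = 3 then (1 : L) else 0).map (algebraMap L (LocalRing L v)))
    {m₀ : MeasurableSpace (Gqs L v ⧸ Subgroup.center (Gqs L v))} [@BorelSpace (Gqs L v ⧸ Subgroup.center (Gqs L v)) _ m₀]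
    (μZ₀ : @Measure (Gqs L v ⧸ Subgroup.center (Gqs L v)) m₀) [μZ₀.IsHaarMeasure]
    {π2 πn : IrrClass (Gqs L v)}
    (hK : KeysCaseTwoLabels L v (μω.semilocalComponent L v) (torusLocalComponent L (IsCMField.complexConj L) v ξ.η)
      (torusLocalComponent L (IsCMField.complexConj L) v ξ.ψ) π2 πn)
    (hn : ¬ πn.IsSquareIntegrable μZ₀)
    {μ : Measure (quasiSplit (↥(maximalRealSubfield L)) L (IsCMField.complexConj L) 3).automorphicQuotient}
    [(quasiSplit (↥(maximalRealSubfield L)) L (IsCMField.complexConj L) 3).IsAutomorphicMeasure μ]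
    (P' : DiscreteAutomorphicRep (quasiSplit (↥(maximalRealSubfield L)) L (IsCMField.complexConj L) 3) μ)
    (hcon : ∀ c : IrrClass ((quasiSplit (↥(maximalRealSubfield L)) L (IsCMField.complexConj L) 3).Local v),
      (IrrClass.comap (localPiEquiv L (IsCMField.complexConj L) 3 ((StdForm.antidiagonal 3).over L) v) c).IsConstituentOf
          (P'.finRep.smoothPart.toRepresentation.comp
            (inclPlace (↥(maximalRealSubfield L)) L (IsCMField.complexConj L) 3 ((StdForm.antidiagonal 3).over L) v)) →
        (IrrClass.comap (cmDatumLocalCongr L v T ha h) c).IsConstituentOf (cmPrincipalSeries L 3 v (cmXiTorusChar L v (μω.semilocalComponent L v)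
          (torusLocalComponent L (IsCMField.complexConj L) v ξ.η) (torusLocalComponent L (IsCMField.complexConj L) v ξ.ψ))) ∧
        ¬ (IrrClass.comap (cmDatumLocalCongr L v T ha h) c).IsSquareIntegrable μZ₀) :
    ∃ (T : GL (Fin 3) (LocalRing L v)) (a : LocalRing L v) (ha : IsUnit a)
      (h : formCongr (conjLocal L (IsCMField.complexConj L) v) T (((StdForm.antidiagonal 3).over L).map (algebraMap L (LocalRing L v))) =
        a • (Matrix.of fun i j : Fin 3 => if i.val + j.val + 1 = 3 then (1 : L) else 0).map (algebraMap L (LocalRing L v)))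
      (x : IrrClass (Gqs L v)),
      x.IsConstituentOf (cmPrincipalSeries L 3 v (cmXiTorusChar L v (μω.semilocalComponent L v)
        (torusLocalComponent L (IsCMField.complexConj L) v ξ.η) (torusLocalComponent L (IsCMField.complexConj L) v ξ.ψ))) ∧
      ¬ x.IsSupercuspidal ∧
      (∀ [MeasurableSpace (Gqs L v ⧸ Subgroup.center (Gqs L v))] [BorelSpace (Gqs L v ⧸ Subgroup.center (Gqs L v))]
          (μZ : Measure (Gqs L v ⧸ Subgroup.center (Gqs L v))) [μZ.IsHaarMeasure], ¬ x.IsSquareIntegrable μZ) ∧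
      ∀ c : IrrClass ((quasiSplit (↥(maximalRealSubfield L)) L (IsCMField.complexConj L) 3).Local v),
        (IrrClass.comap (localPiEquiv L (IsCMField.complexConj L) 3 ((StdForm.antidiagonal 3).over L) v) c).IsConstituentOf
            (P'.finRep.smoothPart.toRepresentation.comp
              (inclPlace (↥(maximalRealSubfield L)) L (IsCMField.complexConj L) 3 ((StdForm.antidiagonal 3).over L) v)) →
          c = IrrClass.comap (cmDatumLocalCongr L v T ha h).symm πn := by
  refine ⟨T, a, ha, h, πn, (hK.2 πn).2 (Or.inl rfl),
    Cruxes.H413.F0P3cStCharTSNe.not_isSupercuspidal_of_not_isSquareIntegrable_gqs L v hns μZ₀ hn, ?_, fun c hc => ?_⟩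
  · -- `πⁿ` is not `L²` for ANY Haar measure on ANY Borel structure: Borel structures coincide, then ★ Keys rigidity across Haar measures
    intro m _ μZ _
    have hm : m = m₀ := by
      rw [@BorelSpace.measurable_eq (Gqs L v ⧸ Subgroup.center (Gqs L v)) _ m ‹_›,
        @BorelSpace.measurable_eq (Gqs L v ⧸ Subgroup.center (Gqs L v)) _ m₀ ‹_›]
    subst hm
    exact (Cruxes.H413.F0P3cDbTKeysLabelRigidity.keysLabelsCM_isSquareIntegrable_of_isHaarMeasure μω hμω ξ hns μZ₀ μZ hK hn).2
  · -- ONE class per place: `comap e c ∈ {πⁿ, π²}` and `π²` IS `L²` for `μZ₀`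
    obtain ⟨hcst, hcL2⟩ := hcon c hc
    rcases (hK.2 _).1 hcst with hcn | hc2
    · rw [← hcn, IrrClass.comap_symm_comap]
    · exact absurd (hc2 ▸ Cruxes.H413.F0P3cStCharTSPi2SqInt.isSquareIntegrable_pi2_of_keysLabels L μω hμω ξ v hns μZ₀ hK hn) hcL2

end Keys

end Summit.HodgeConjecture.HodgeConjecture.R90.S8

end
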